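import Mathlib
import Summits.ResolutionOfSingularities.ResolutionOfSingularities.Theorems.AbhyankarShadowsSemivaluationShadowsFrameShadow
import Summits.ResolutionOfSingularities.ResolutionOfSingularities.Theorems.AbhyankarShadowsSemivaluationShadowsHenselOverRuledShadowsRankOneHelpers
import Summits.ResolutionOfSingularities.ResolutionOfSingularities.Theorems.AbhyankarShadowsSemivaluationShadowsCyclicValueGroup
import Summits.ResolutionOfSingularities.ResolutionOfSingularities.Theorems.AbhyankarShadowsShadowsUniformizeLurelDiscrete
import Literature.AlgebraicGeometry.Resolution.SubfieldTransport
import Literature.AlgebraicGeometry.Resolution.RankOneDensity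
import HarnessLib

/-!
# Hensel-generated top layers: Newton approximants and the one-element frame
(helpers for `stub_henselOverRuledShadowsRankOne`, II)

Support file for the registered stub `stub_henselOverRuledShadowsRankOne` of the crux
`stmt-ResolutionOfSingularities-16757` (`Theses.AbhyankarShadows.SemivaluationShadows`, line
`birth`):

* `HenselShadows.exists_approximant` — UPSTAIRS: for a Hensel root `η` over `O ∩ K₁` and a
  finite family of polynomials `qⱼ` with coefficient bounds `bⱼ`, one Newton approximant
  `a ∈ K₁ ∩ O` of `η` (`exists_mem_valuation_sub_le_pow` + the archimedean axiom) with
  `v(h'(a)) = 1`, `v(bⱼ h(a)) < v(qⱼ(a)) = v(qⱼ(η))` for every `j` with `qⱼ(η) ≠ 0`;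
* `HenselShadows.exists_mem_valuation_eq` — DOWNSTAIRS: if `ζ ∈ V` is a Hensel root over
  `V ∩ L₀` with a first-order approximant `c ∈ L₀`, every non-zero `q(ζ)` (`q` over `L₀`) has
  the value of an element of `L₀` (no ramification in `L₀(ζ) / L₀`);
* `HenselShadows.frameShadow_one` — the frame transfer `frameShadow` for a ONE-element frame
  `ẽ ↦ φ ẽ` generating the value group downstairs.

No named facts are used. [folklore]
-/

set_option linter.dupNamespace false

noncomputable section

open Polynomial Literature.AlgebraicGeometry.Resolution

namespace Summit.ResolutionOfSingularities.ResolutionOfSingularities.Theorems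

namespace HenselShadows

/-! ## Upstairs: one Newton approximant serving finitely many polynomials -/

/-- **One Newton approximant for finitely many prescribed polynomials.** Let `η ∈ O` be a
Hensel root of `h` (coefficients in `O ∩ K₁`, `h(η) = 0`, `v(h'(η)) = 1`) with first-order
approximant `c₀ ∈ K₁ ∩ O`, let the value group satisfy the archimedean axiom, and let `QB` be a
finite set of pairs `(q, b)` with `v(qₙ) ≤ v(b)` for all coefficients. Then some Newton
approximant `a ∈ K₁ ∩ O` of `η` (`v(a - c₀) < 1`, `v(η - a) < 1`, `v(h'(a)) = 1`) satisfies the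
GAP inequality `v(b · h(a)) < v(q(a))` and `v(q(a)) = v(q(η))` for every `(q, b) ∈ QB` with
`q(η) ≠ 0`. [folklore] -/
theorem exists_approximant {K : Type*} [Field K] (O : ValuationSubring K) (K₁ : Subfield K)
    (harch : ∀ B γ δ : ValuationSubring.ValueGroup O, γ < 1 → δ ≠ 0 →
      ∃ n : ℕ, B * γ ^ (n + 1) < δ)
    {h : K[X]} (hcoefO : ∀ n, h.coeff n ∈ O) (hcoefK : ∀ n, h.coeff n ∈ K₁) {η : K}
    (hηO : η ∈ O) (hroot : h.eval η = 0) (hder : O.valuation ((derivative h).eval η) = 1)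
    {c₀ : K} (hc₀K : c₀ ∈ K₁) (hc₀O : c₀ ∈ O) (hlt : O.valuation (η - c₀) < 1)
    (QB : Finset (K[X] × K)) (hQB : ∀ p ∈ QB, ∀ n, O.valuation (p.1.coeff n) ≤ O.valuation p.2) :
    ∃ a ∈ K₁, a ∈ O ∧ O.valuation (a - c₀) < 1 ∧ O.valuation ((derivative h).eval a) = 1 ∧
      O.valuation (η - a) < 1 ∧
      ∀ p ∈ QB, p.1.eval η ≠ 0 →
        O.valuation (p.2 * h.eval a) < O.valuation (p.1.eval a) ∧
        O.valuation (p.1.eval a) = O.valuation (p.1.eval η) := by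
  classical
  set ε := O.valuation (η - c₀) with hε
  -- an index for each pair
  have hidx : ∀ p : K[X] × K, ∃ n₀ : ℕ, ∀ n, n₀ ≤ n → p.1.eval η ≠ 0 →
      O.valuation p.2 * ε ^ (n + 1) < O.valuation (p.1.eval η) := by
    intro p
    by_cases hp : p.1.eval η = 0
    · exact ⟨0, fun n _ h0 => absurd hp h0⟩
    · obtain ⟨n₀, hn₀⟩ := exists_forall_mul_pow_lt harch (O.valuation p.2) ε _ hlt
        ((Valuation.ne_zero_iff _).mpr hp)
      exact ⟨n₀, fun n hn _ => hn₀ n hn⟩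
  choose idx hidx using hidx
  set N : ℕ := QB.sup idx with hN
  obtain ⟨a, haK, haO, hale⟩ :=
    exists_mem_valuation_sub_le_pow O hcoefO hcoefK hηO hroot hder hc₀K hc₀O hlt N
  have hεN : ε ^ (N + 1) ≤ ε := by
    calc ε ^ (N + 1) ≤ ε ^ 1 := pow_le_pow_of_le_one zero_le hlt.le (by omega)
      _ = ε := pow_one ε
  have hηa : O.valuation (η - a) < 1 := lt_of_le_of_lt (hale.trans hεN) hlt
  have haη : O.valuation (a - η) < 1 := by rwa [Valuation.map_sub_swap]
  -- `v(h(a)) ≤ ε ^ (N+1)`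
  have hha : O.valuation (h.eval a) ≤ ε ^ (N + 1) := by
    have h1 : h.eval a = h.eval a - h.eval η := by rw [hroot, sub_zero]
    rw [h1]
    exact (valuation_eval_sub_eval_le O hcoefO haO hηO).trans
      (by rw [Valuation.map_sub_swap]; exact hale)
  refine ⟨a, haK, haO, ?_, ?_, hηa, ?_⟩
  · have h1 : a - c₀ = (η - c₀) - (η - a) := by ring
    rw [h1]
    exact Valuation.map_sub_lt _ hlt hηa
  · have hdcoef : ∀ n, (derivative h).coeff n ∈ O := coeff_derivative_mem_valuationSubring O hcoefO
    have h1 : O.valuation ((derivative h).eval a - (derivative h).eval η) < 1 :=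
      lt_of_le_of_lt (valuation_eval_sub_eval_le O hdcoef haO hηO) haη
    have h2 : (derivative h).eval a = ((derivative h).eval a - (derivative h).eval η) +
        (derivative h).eval η := by ring
    rw [h2, Valuation.map_add_eq_of_lt_right, hder]
    rwa [hder]
  · intro p hp hp0
    have hn := hidx p N (Finset.le_sup hp) hp0
    have hδ : O.valuation (p.1.eval η - p.1.eval a) < O.valuation (p.1.eval η) := by
      calc O.valuation (p.1.eval η - p.1.eval a)
          ≤ O.valuation p.2 * O.valuation (η - a) := eval_sub_eval_le_mul O p.1 (hQB p hp) hηO haO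
        _ ≤ O.valuation p.2 * ε ^ (N + 1) := mul_le_mul' le_rfl hale
        _ < O.valuation (p.1.eval η) := hn
    have heq : O.valuation (p.1.eval a) = O.valuation (p.1.eval η) := by
      have h1 : p.1.eval a = p.1.eval η - (p.1.eval η - p.1.eval a) := by ring
      rw [h1]
      exact Valuation.map_sub_eq_of_lt_left _ hδ
    refine ⟨?_, heq⟩
    rw [heq, map_mul]
    calc O.valuation p.2 * O.valuation (h.eval a) ≤ O.valuation p.2 * ε ^ (N + 1) :=
        mul_le_mul' le_rfl hha
      _ < O.valuation (p.1.eval η) := hn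

/-! ## Downstairs: no ramification along a Hensel root -/

/-- **Values of `L₀(ζ)` are values of `L₀`.** Let `ζ ∈ V` be a Hensel root over `V ∩ L₀`
(`P(ζ) = 0`, `P` with coefficients in `V ∩ L₀`, `v(P'(ζ)) = 1`) with a first-order approximant
`c ∈ L₀ ∩ V`, and let the value group satisfy the archimedean axiom. Then for every polynomial
`q` with coefficients in `L₀` and `q(ζ) ≠ 0` there is `w ∈ L₀` with `v(q(ζ)) = v(w)`: take
`w = q(a)` for a Newton approximant `a ∈ L₀` of `ζ` beyond the precision `v(q(ζ)) / max v(qᵢ)`.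
[folklore] -/
theorem exists_mem_valuation_eq {M : Type*} [Field M] (V : ValuationSubring M) (L₀ : Subfield M)
    (harch : ∀ B γ δ : ValuationSubring.ValueGroup V, γ < 1 → δ ≠ 0 →
      ∃ n : ℕ, B * γ ^ (n + 1) < δ)
    {P : M[X]} (hPV : ∀ n, P.coeff n ∈ V) (hPL : ∀ n, P.coeff n ∈ L₀) {ζ : M} (hζV : ζ ∈ V)
    (hroot : P.eval ζ = 0) (hder : V.valuation ((derivative P).eval ζ) = 1) {c : M}
    (hcL : c ∈ L₀) (hcV : c ∈ V) (hlt : V.valuation (ζ - c) < 1) (q : M[X])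
    (hq : ∀ n, q.coeff n ∈ L₀) (hq0 : q.eval ζ ≠ 0) :
    ∃ w ∈ L₀, V.valuation (q.eval ζ) = V.valuation w := by
  classical
  have hqne : q ≠ 0 := fun h0 => hq0 (by rw [h0, eval_zero])
  obtain ⟨i₀, -, hi₀⟩ := Finset.exists_max_image q.support (fun i => V.valuation (q.coeff i))
    (Polynomial.support_nonempty.mpr hqne)
  set B := V.valuation (q.coeff i₀) with hB
  have hBle : ∀ i, V.valuation (q.coeff i) ≤ B := by
    intro i
    by_cases hi : i ∈ q.support
    · exact hi₀ i hi
    · rw [Polynomial.notMem_support_iff.mp hi, map_zero]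
      exact zero_le
  obtain ⟨n, hn⟩ := harch B (V.valuation (ζ - c)) (V.valuation (q.eval ζ)) hlt
    ((Valuation.ne_zero_iff _).mpr hq0)
  obtain ⟨a, haL, haV, hale⟩ :=
    exists_mem_valuation_sub_le_pow V hPV hPL hζV hroot hder hcL hcV hlt n
  refine ⟨q.eval a, eval_mem_subfield_of_coeff_mem hq haL, ?_⟩
  have hdiff : V.valuation (q.eval ζ - q.eval a) < V.valuation (q.eval ζ) := by
    calc V.valuation (q.eval ζ - q.eval a) ≤ B * V.valuation (ζ - a) :=
        eval_sub_eval_le_mul V q hBle hζV haV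
      _ ≤ B * V.valuation (ζ - c) ^ (n + 1) := mul_le_mul' le_rfl hale
      _ < V.valuation (q.eval ζ) := hn
  have h1 : q.eval a = q.eval ζ - (q.eval ζ - q.eval a) := by ring
  rw [h1, Valuation.map_sub_eq_of_lt_left _ hdiff]

/-! ## The one-element frame -/

/-- **The frame transfer for a one-element frame.** `frameShadow` with `r = 1`: the frame is a
single element `ẽ ∈ R₁` with `0 < v(ẽ) < 1` whose image `φ ẽ` has value `< 1` generating the
value group of `O'`; then independence, order-compatibility and the `ℕ`-monomial clause are
automatic, and exactness on `F` is asked with one integer exponent. Conclusion: the crux's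
`HasShadow O R F`, unfolded. [folklore] -/
theorem frameShadow_one (k K : Type) [Field k] [Field K] [Algebra k K] (O : ValuationSubring K)
    (hk : ∀ c : k, algebraMap k K c ∈ O)
    (hrat : ∀ x : K, x ∈ O → ∃ c : k, O.valuation (x - algebraMap k K c) < 1)
    (hrr : Module.finrank ℤ (Additive (O.ValueGroup)ˣ) = 1) (R R₁ : Subalgebra k K)
    (hle : R ≤ R₁) (h₁O : R₁.toSubring ≤ O.toSubring) (hfg₁ : R₁.FG)
    (hfrac : IsFractionRing R₁ K) (L : Type) [Field L] [Algebra k L] (φ : R₁ →ₐ[k] L)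
    (O' : ValuationSubring L) (hin : ∀ y : R₁, φ y ∈ O')
    (hcen : ∀ y : R₁, O'.valuation (φ y) < 1 ↔ O.valuation (y : K) < 1)
    (hrat' : ∀ z : L, z ∈ O' → ∃ c : k, O'.valuation (z - algebraMap k L c) < 1)
    (e₀ : R₁) (he0 : ((e₀ : R₁) : K) ≠ 0) (he1 : O.valuation ((e₀ : R₁) : K) < 1)
    (heφ0 : φ e₀ ≠ 0) (heφ1 : O'.valuation (φ e₀) < 1)
    (hgen : ∀ z : L, z ≠ 0 → ∃ m : ℤ, O'.valuation z = O'.valuation (φ e₀) ^ m)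
    (F : Finset R)
    (hexF : ∀ x ∈ F, ((x : R) : K) ≠ 0 → φ (Subalgebra.inclusion hle x) ≠ 0 ∧
      ∃ m : ℤ, O'.valuation (φ (Subalgebra.inclusion hle x)) = O'.valuation (φ e₀) ^ m ∧
        O.valuation ((x : R) : K) = O.valuation ((e₀ : R₁) : K) ^ m) :
    ∃ (R₁ : Subalgebra k K) (hle : R ≤ R₁) (_ : R₁.toSubring ≤ O.toSubring), R₁.FG ∧
    IsFractionRing R₁ K ∧ ∃ (L : Type) (_ : Field L) (_ : Algebra k L) (φ : R₁ →ₐ[k] L)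
    (O' : ValuationSubring L), Module.finrank ℤ (Additive (O'.ValueGroup)ˣ) =
      Module.finrank ℤ (Additive (O.ValueGroup)ˣ) ∧ (∀ y : R₁, φ y ∈ O') ∧
    (∀ y : R₁, O'.valuation (φ y) < 1 ↔ O.valuation (y : K) < 1) ∧
    (∀ z : L, z ∈ O' → ∃ c : k, O'.valuation (z - algebraMap k L c) < 1) ∧
    (MonoidHom.mrange (O'.valuation.toMonoidWithZeroHom.toMonoidHom.comp
      φ.toRingHom.toMonoidHom)).FG ∧
    ∃ ι : O'.ValueGroup →*₀o O.ValueGroup, Function.Injective ι ∧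
      (∀ y : R₁, φ y ≠ 0 → ∃ y' : R₁, ι (O'.valuation (φ y)) = O.valuation (y' : K)) ∧
      ∀ x ∈ F, ι (O'.valuation (φ (Subalgebra.inclusion hle x))) = O.valuation ((x : R) : K) := by
  have hvpos : 0 < O.valuation ((e₀ : R₁) : K) := (Valuation.pos_iff _).mpr he0
  have hv'pos : 0 < O'.valuation (φ e₀) := (Valuation.pos_iff _).mpr heφ0
  refine frameShadow k K O hk hrat 1 hrr R R₁ hle h₁O hfg₁ hfrac L φ O' hin hcen hrat'
    (fun _ => e₀) (fun _ => he0) (fun _ => heφ0) ?_ ?_ ?_ ?_ F ?_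
  · intro z hz
    obtain ⟨m, hm⟩ := hgen z hz
    exact ⟨fun _ => m, by rw [Fin.prod_univ_one, hm]⟩
  · intro m hm
    rw [Fin.prod_univ_one] at hm
    have h0 : m 0 = 0 := (zpow_eq_one_iff_right₀ zero_le he1.ne).mp hm
    funext i
    rw [Subsingleton.elim i 0, h0]
    rfl
  · intro m
    rw [Fin.prod_univ_one, Fin.prod_univ_one, zpow_le_one_iff_right_of_lt_one₀ hv'pos heφ1,
      zpow_le_one_iff_right_of_lt_one₀ hvpos he1]
  · intro y hy
    obtain ⟨m, hm⟩ := hgen (φ y) hy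
    have hle1 : O'.valuation (φ y) ≤ 1 := (O'.valuation_le_one_iff _).mpr (hin y)
    rw [hm, zpow_le_one_iff_right_of_lt_one₀ hv'pos heφ1] at hle1
    refine ⟨fun _ => m.toNat, ?_⟩
    rw [Fin.prod_univ_one, hm, ← zpow_natCast, Int.toNat_of_nonneg hle1]
  · intro x hx hx0
    obtain ⟨hφ0, m, h1, h2⟩ := hexF x hx hx0
    exact ⟨hφ0, fun _ => m, by rw [Fin.prod_univ_one]; exact h1, by rw [Fin.prod_univ_one]; exact h2⟩

/-! ## Upstairs algebra: the minimal polynomial and its cofactor; representations -/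

/-- **Minimal polynomial and cofactor of a simple root.** Let `h ∈ K[X]` be monic with
coefficients in the intermediate field `K₁`, `h(η) = 0` and `h'(η) ≠ 0`. Then `h = m · g` with
`m` the (image of the) minimal polynomial of `η` over `K₁` — monic, coefficients in `K₁`,
`m(η) = 0`, and MINIMAL: a polynomial with coefficients in `K₁` vanishing at `η` of smaller
degree is zero — and `g` with coefficients in `K₁` and `g(η) ≠ 0` (as
`h'(η) = m'(η) g(η)`). [folklore] -/
theorem exists_minpoly_cofactor {F K : Type*} [Field F] [Field K] [Algebra F K]
    (K₁ : IntermediateField F K) {h : K[X]} (hcoef : ∀ i, h.coeff i ∈ K₁) (hmon : h.Monic)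
    {η : K} (hroot : h.eval η = 0) (hder : (derivative h).eval η ≠ 0) :
    ∃ m g : K[X], m.Monic ∧ (∀ i, m.coeff i ∈ K₁) ∧ (∀ i, g.coeff i ∈ K₁) ∧ h = m * g ∧
      m.eval η = 0 ∧ g.eval η ≠ 0 ∧ IsIntegral K₁ η ∧
      ∀ r : K[X], (∀ i, r.coeff i ∈ K₁) → r.eval η = 0 → r.degree < m.degree → r = 0 := by
  have hinjK₁ : Function.Injective (algebraMap K₁ K) := (algebraMap K₁ K).injective
  have hliftK₁ : ∀ r : K[X], (∀ i, r.coeff i ∈ K₁) →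
      ∃ r₁ : K₁[X], r₁.map (algebraMap K₁ K) = r := fun r hr =>
    (mem_lifts r).mp ((lifts_iff_coeff_lifts r).mpr fun n => ⟨⟨r.coeff n, hr n⟩, rfl⟩)
  obtain ⟨h₁, hh₁⟩ := hliftK₁ h hcoef
  have hh₁mon : h₁.Monic := monic_of_injective hinjK₁ (by rw [hh₁]; exact hmon)
  have hη₁ : aeval η h₁ = 0 := by rw [aeval_def, ← eval_map, hh₁]; exact hroot
  have hint : IsIntegral K₁ η := ⟨h₁, hh₁mon, by rw [← aeval_def]; exact hη₁⟩
  set m₁ : K₁[X] := minpoly K₁ η with hm₁def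
  set m : K[X] := m₁.map (algebraMap K₁ K) with hmdef
  set g₁ : K₁[X] := h₁ /ₘ m₁ with hg₁def
  have hh₁eq : h₁ = m₁ * g₁ := by
    have h0 : h₁ %ₘ m₁ = 0 :=
      (modByMonic_eq_zero_iff_dvd (minpoly.monic hint)).mpr (minpoly.dvd K₁ η hη₁)
    have := modByMonic_add_div h₁ m₁
    rw [h0, zero_add] at this
    exact this.symm
  set g : K[X] := g₁.map (algebraMap K₁ K) with hgdef
  have hhmg : h = m * g := by rw [← hh₁, hh₁eq, Polynomial.map_mul]
  have hmη : m.eval η = 0 := by rw [hmdef, eval_map, ← aeval_def]; exact minpoly.aeval K₁ η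
  refine ⟨m, g, (minpoly.monic hint).map _, fun i => ?_, fun i => ?_, hhmg, hmη, ?_, hint, ?_⟩
  · rw [hmdef, coeff_map]; exact (m₁.coeff i).2
  · rw [hgdef, coeff_map]; exact (g₁.coeff i).2
  · intro h0
    apply hder
    rw [hhmg, derivative_mul, eval_add, eval_mul, eval_mul, hmη, h0, mul_zero, zero_mul,
      add_zero]
  · intro r hr hr0 hdeg
    obtain ⟨r₁, rfl⟩ := hliftK₁ r hr
    by_cases hr₁ : r₁ = 0
    · rw [hr₁, Polynomial.map_zero]
    · exfalso
      have hroot₁ : aeval η r₁ = 0 := by rwa [aeval_def, ← eval_map]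
      have hle := minpoly.degree_le_of_ne_zero K₁ η hr₁ hroot₁
      rw [degree_map_eq_of_injective hinjK₁, hmdef, degree_map_eq_of_injective hinjK₁] at hdeg
      exact absurd hle (not_le.mpr hdeg)

/-- **Representations over `K₁ = F(v)`.** If `K = F(v, η)` with `η` integral over `F(v)`,
every `z ∈ K` is `q(η)` for a polynomial `q` with coefficients in `F(v)`. [folklore] -/
theorem exists_rep {F K : Type*} [Field F] [Field K] [Algebra F K] (v η : K)
    (hgen : IntermediateField.adjoin F {v, η} = ⊤)
    (hint : IsIntegral (IntermediateField.adjoin F {v}) η) (z : K) :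
    ∃ q : K[X], (∀ i, q.coeff i ∈ IntermediateField.adjoin F {v}) ∧ q.eval η = z := by
  have hz : z ∈ IntermediateField.adjoin (IntermediateField.adjoin F {v}) {η} := by
    rw [← IntermediateField.mem_restrictScalars F, IntermediateField.adjoin_simple_adjoin_simple,
      hgen]
    trivial
  rw [← IntermediateField.mem_toSubalgebra,
    IntermediateField.adjoin_simple_toSubalgebra_of_isAlgebraic hint.isAlgebraic,
    Algebra.adjoin_singleton_eq_range_aeval] at hz
  obtain ⟨q₁, hq₁⟩ := hz
  refine ⟨q₁.map (algebraMap _ K), fun i => ?_, ?_⟩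
  · rw [coeff_map]; exact (q₁.coeff i).2
  · rw [eval_map, ← aeval_def]; exact hq₁

/-! ## Downstairs: a uniformiser of `F₀(ρ')` that is a polynomial of small degree -/

/-- **A low-degree uniformising polynomial.** Let `F₀ → M` be fields, `V` a valuation ring of
`M` whose values on `F₀ˣ` are the integral powers of the value `< 1` of `t ∈ F₀`, and `ρ' ∈ M`
integral over `F₀`. Then the value group of `F₀(ρ')` is CYCLIC (`isCyclic_valueGroup_of_finite`)
and a uniformiser is `g_π(ρ')` for some non-zero `g_π ∈ F₀[X]` of degree `< deg (minpoly ρ')`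
(power basis): every non-zero element of `F₀(ρ')` has value `V(g_π(ρ'))^n`, `n ∈ ℤ`.
[folklore] -/
theorem exists_uniformizing_polynomial {F₀ M : Type} [Field F₀] [Field M] [Algebra F₀ M]
    (V : ValuationSubring M) (t : F₀) (ht0 : algebraMap F₀ M t ≠ 0)
    (ht1 : V.valuation (algebraMap F₀ M t) < 1)
    (hdisc : ∀ x : F₀, x ≠ 0 → ∃ n : ℤ,
      V.valuation (algebraMap F₀ M x) = V.valuation (algebraMap F₀ M t) ^ n)
    {ρ' : M} (hρ' : IsIntegral F₀ ρ') :
    ∃ gπ : F₀[X], gπ ≠ 0 ∧ gπ.natDegree < (minpoly F₀ ρ').natDegree ∧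
      V.valuation (aeval ρ' gπ) < 1 ∧ aeval ρ' gπ ≠ 0 ∧
      ∀ w : M, w ∈ IntermediateField.adjoin F₀ {ρ'} → w ≠ 0 →
        ∃ n : ℤ, V.valuation w = V.valuation (aeval ρ' gπ) ^ n := by
  set L₀f : IntermediateField F₀ M := IntermediateField.adjoin F₀ {ρ'} with hL₀fdef
  haveI : FiniteDimensional F₀ L₀f := IntermediateField.adjoin.finiteDimensional hρ'
  set O₀ : ValuationSubring L₀f := V.comap (algebraMap L₀f M) with hO₀def
  have hO₀V : V.comap (algebraMap L₀f M) = O₀ := rfl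
  have hcoe : ∀ x : F₀, ((algebraMap F₀ L₀f x : L₀f) : M) = algebraMap F₀ M x := fun x => rfl
  have ht₀L0 : algebraMap F₀ L₀f t ≠ 0 := by
    intro h0
    apply ht0
    have h1 := congrArg (fun z : L₀f => (z : M)) h0
    simpa only [hcoe, ZeroMemClass.coe_zero] using h1
  have hdisc₀ : ∀ x : F₀, x ≠ 0 → ∃ n : ℤ, O₀.valuation (algebraMap F₀ L₀f x) =
      O₀.valuation (algebraMap F₀ L₀f t) ^ n := by
    intro x hx
    obtain ⟨n, hn⟩ := hdisc x hx
    refine ⟨n, ?_⟩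
    rw [← map_zpow₀, ← valuation_map_eq_iff (algebraMap L₀f M) hO₀V, map_zpow₀, map_zpow₀,
      IntermediateField.algebraMap_apply, IntermediateField.algebraMap_apply, hcoe, hcoe]
    exact hn
  have hcyc : IsCyclic (O₀.ValueGroup)ˣ := isCyclic_valueGroup_of_finite O₀ t ht₀L0 hdisc₀
  have htL₀1 : O₀.valuation (algebraMap F₀ L₀f t) < 1 := by
    rw [← valuation_map_lt_one_iff (algebraMap L₀f M) hO₀V, IntermediateField.algebraMap_apply,
      hcoe]
    exact ht1
  obtain ⟨πL, hπ0, hπ1, hπgen⟩ :=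
    exists_uniformizer_of_isCyclic O₀ hcyc ⟨_, ht₀L0, htL₀1.ne⟩
  obtain ⟨gπ, hgπdeg, hgπ⟩ := (IntermediateField.adjoin.powerBasis hρ').exists_eq_aeval πL
  rw [IntermediateField.adjoin.powerBasis_dim] at hgπdeg
  rw [IntermediateField.adjoin.powerBasis_gen] at hgπ
  have hπρ' : (πL : M) = aeval ρ' gπ := by
    rw [hgπ]
    change algebraMap L₀f M (aeval (IntermediateField.AdjoinSimple.gen F₀ ρ') gπ) = aeval ρ' gπ
    rw [← aeval_algebraMap_apply, IntermediateField.AdjoinSimple.algebraMap_gen]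
  have hgπ0 : gπ ≠ 0 := fun h0 => hπ0 (by rw [hgπ, h0, map_zero])
  have hπ1V : V.valuation (πL : M) < 1 :=
    (valuation_map_lt_one_iff (algebraMap L₀f M) hO₀V πL).mpr hπ1
  have hπ0M : (πL : M) ≠ 0 := fun h0 => hπ0 (Subtype.ext h0)
  refine ⟨gπ, hgπ0, hgπdeg, hπρ' ▸ hπ1V, hπρ' ▸ hπ0M, fun w hw hw0 => ?_⟩
  obtain ⟨n, hn⟩ := hπgen ⟨w, hw⟩ fun h0 => hw0 (congrArg Subtype.val h0)
  refine ⟨n, ?_⟩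
  have := (valuation_map_eq_iff (algebraMap L₀f M) hO₀V ⟨w, hw⟩ (πL ^ n)).mpr
    (by rw [map_zpow₀]; exact hn)
  rw [map_zpow₀, map_zpow₀] at this
  rw [← hπρ']
  exact this

end HenselShadows

end Summit.ResolutionOfSingularities.ResolutionOfSingularities.Theorems

end
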